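/-
Copyright (c) 2026 the pub-hodgecm-mathlib formalisation cell (harness21).  Prover seat hodgecm-mathlib-K2E5-p16 (g4): Track B «K2-LIT»,
hLiu418 = stmt-HodgeConjecture-24832, ROAD Φ organ Φ6b-1⁺ (self-offered under LEAD F0P6-plan (g12) ∕ co-dealer K2E5-plan (g5), K2 bus
2026-09-04T06:1xZ): REGULARITY of Shimura's `ξ(g, h; α, β)` on its region of absolute convergence — the lower bound `|det(g + ix)| ≥ det g`
and continuity in `h`; 2026-09-04.
-/
import Summits.HodgeConjecture.HodgeConjecture.Theorems.K2LiuHermTwoConfluentXiConvergence  -- ★ (this seat): domination + integrability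
import HarnessLib

/-!
# Crux `HLiu418`, ROAD Φ, organ Φ6b-1⁺: regularity of Shimura's `ξ(g, h; α, β)` in `h` and the lower bound `|det(g + ix)| ≥ det g`

Cell `hodgecm-mathlib`, crux item hLiu418 = `stmt-HodgeConjecture-24832`, route of record `HCCMUnconditional`; squad K2, LEAD F0P6-plan (g12), co-dealer
K2E5-plan (g5), prover K2E5-p16 (g4).  THEOREMS ONLY (no `def`, no instance, no notation, no named-fact hypothesis, no `sorry`, default heartbeats);
lane `--supports stmt-HodgeConjecture-24832 --as helper` (count-neutral helper).

WHAT IS PROVED.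
* `det_le_norm_det_add_I_smul_hermTwo` ∕ `det_le_norm_det_add_I_smul` — THE LOWER BOUND `det g ≤ |det(g + ix)|` for `g > 0`, `x` Hermitian
  (from ★ `normSq_det_eq_quadratic`: `|det(g+ix)|² = (a²+p²)((b+μ)²+ν²) ≥ p²ν² ≥ (det g)²`, since `ν ≥ det g/p`); consequently
  `norm_det_add_I_smul_rpow_neg_le` — `|det(g + ix)|^{−σ} ≤ (det g)^{−σ}` for `σ ≥ 0` (the majorant is BOUNDED, not only integrable);
* `norm_xiTwoIntegrand_le_const` — `‖ξ-integrand‖ ≤ e^{2π(|im α|+|im β|)} (det g)^{−re(α+β)}` pointwise (`re(α+β) ≥ 0`);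
* `continuous_xiTwoIntegrand_param` — the integrand is jointly continuous in `(h, x)` through the chart `h = hermTwo e`;
* `continuous_xiTwo_hermTwo` — for `g > 0` and `re(α+β) > 3`, `e ↦ ξ(g, hermTwo e; α, β)` is CONTINUOUS on `ℝ × ℂ × ℝ` (all Hermitian `h`),
  by dominated convergence (★ `continuous_of_dominated`) with the `h`-independent majorant ★ `integrable_norm_det_add_I_smul_rpow_neg`.
NOT here: holomorphy in `(α, β)` (sequel), the continuation beyond `re(α+β) > 3` (print-gated, acq-15212).
HONEST LABEL.  Count-neutral helper of the K2_Liu road; it pays no socket by itself: `HC_CM` is proved only modulo the 7 printed citations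
(2 remaining named inputs: hLiu418 = `stmt-HodgeConjecture-24832`, h413 = `stmt-HodgeConjecture-24833`) until rung 0 closes.
References (orientation only): [Shimura1982] §1 (1.25)–(1.29).
-/

set_option autoImplicit false
-- the mandated namespace repeats the single-problem summit's segment (`HodgeConjecture.HodgeConjecture`)
set_option linter.dupNamespace false

noncomputable section

open Complex MeasureTheory Set
open scoped ComplexOrder ComplexConjugate

namespace Summit.HodgeConjecture.HodgeConjecture.Cruxes.HLiu418.K2LiuHermTwoConfluentXiRegularity

open Summit.HodgeConjecture.HodgeConjecture.Cruxes.HLiu418.K2LiuHermTwoGammaDefs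
open Summit.HodgeConjecture.HodgeConjecture.Cruxes.HLiu418.K2LiuHermTwoDetPowerFibres
open Summit.HodgeConjecture.HodgeConjecture.Cruxes.HLiu418.K2LiuHermTwoDetPowerIntegrable
open Summit.HodgeConjecture.HodgeConjecture.Cruxes.HLiu418.K2LiuHermTwoConfluentXiDefs
open Summit.HodgeConjecture.HodgeConjecture.Cruxes.HLiu418.K2LiuHermTwoConfluentXiConvergence

/-! ## The lower bound `|det(g + ix)| ≥ det g` -/

/-- Chart form: for `g = hermTwo (p, w, q)` with `0 < p`, `|w|² < pq`, and every `x = hermTwo c`: `pq − |w|² ≤ |det(g + ix)|`. -/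
theorem det_le_norm_det_add_I_smul_hermTwo (d : ℝ × ℂ × ℝ) (hd : 0 < d.1 ∧ normSq d.2.1 < d.1 * d.2.2) (c : ℝ × ℂ × ℝ) :
    d.1 * d.2.2 - normSq d.2.1 ≤ ‖(hermTwo d + I • hermTwo c).det‖ := by
  obtain ⟨p, w, q⟩ := d
  obtain ⟨a, z, b⟩ := c
  have hp : 0 < p := hd.1
  have hpq : normSq w < p * q := hd.2
  have hδ : 0 < p * q - normSq w := by linarith
  have hX : p ^ 2 ≤ a ^ 2 + p ^ 2 := by nlinarith [sq_nonneg a]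
  -- `ν ≥ δ / p`
  have hν : (p * q - normSq w) / p ≤
      (p * ‖z - ((a / p : ℝ) : ℂ) * w‖ ^ 2 + (a ^ 2 + p ^ 2) * (p * q - normSq w) / p) / (a ^ 2 + p ^ 2) := by
    rw [div_le_div_iff₀ hp (by positivity)]
    have h1 : 0 ≤ p * ‖z - ((a / p : ℝ) : ℂ) * w‖ ^ 2 * p := by positivity
    have h2 : (p * ‖z - ((a / p : ℝ) : ℂ) * w‖ ^ 2 + (a ^ 2 + p ^ 2) * (p * q - normSq w) / p) * p =
        p * ‖z - ((a / p : ℝ) : ℂ) * w‖ ^ 2 * p + (a ^ 2 + p ^ 2) * (p * q - normSq w) := by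
      field_simp
    rw [h2]
    nlinarith
  have hνpos := nu_pos (q := q) hp hpq a z
  -- `|det|² ≥ (a²+p²) ν² ≥ p² (δ/p)² = δ²`
  have hsq : (p * q - normSq w) ^ 2 ≤ ‖(hermTwo (p, w, q) + I • hermTwo (a, z, b)).det‖ ^ 2 := by
    rw [Complex.sq_norm, normSq_det_eq_quadratic hp a z b]
    have h3 : (p * q - normSq w) ^ 2 = p ^ 2 * ((p * q - normSq w) / p) ^ 2 := by
      field_simp
    rw [h3]
    have h4 : ((p * q - normSq w) / p) ^ 2 ≤
        ((p * ‖z - ((a / p : ℝ) : ℂ) * w‖ ^ 2 + (a ^ 2 + p ^ 2) * (p * q - normSq w) / p) / (a ^ 2 + p ^ 2)) ^ 2 :=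
      pow_le_pow_left₀ (div_pos hδ hp).le hν 2
    nlinarith [sq_nonneg (b + (p * (q * a - 2 * (w * conj z).re) - a * (p * q - normSq w + normSq z)) / (a ^ 2 + p ^ 2)),
      hνpos, h4, hX, sq_nonneg ((p * q - normSq w) / p)]
  exact (pow_le_pow_iff_left₀ hδ.le (norm_nonneg _) two_ne_zero).mp hsq

/-- THE LOWER BOUND: for `g` positive definite and `x` Hermitian (chart), `det g ≤ |det(g + ix)|` (`det g = g₀₀ g₁₁ − |g₀₁|² > 0`). -/
theorem det_le_norm_det_add_I_smul {g : Matrix (Fin 2) (Fin 2) ℂ} (hg : g.PosDef) (c : ℝ × ℂ × ℝ) :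
    (g 0 0).re * (g 1 1).re - normSq (g 0 1) ≤ ‖(g + I • hermTwo c).det‖ := by
  have hg' : hermTwo ((g 0 0).re, g 0 1, (g 1 1).re) = g := hermTwo_eq_of_isHermitian hg.1
  have hd := (posDef_hermTwo_iff ((g 0 0).re, g 0 1, (g 1 1).re)).mp (hg'.symm ▸ hg)
  conv_rhs => rw [← hg']
  exact det_le_norm_det_add_I_smul_hermTwo _ hd c

/-- `det g > 0` in the coordinates used above. -/
theorem det_re_pos_of_posDef {g : Matrix (Fin 2) (Fin 2) ℂ} (hg : g.PosDef) : 0 < (g 0 0).re * (g 1 1).re - normSq (g 0 1) := by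
  have hg' : hermTwo ((g 0 0).re, g 0 1, (g 1 1).re) = g := hermTwo_eq_of_isHermitian hg.1
  have hd := (posDef_hermTwo_iff ((g 0 0).re, g 0 1, (g 1 1).re)).mp (hg'.symm ▸ hg)
  have h : normSq (g 0 1) < (g 0 0).re * (g 1 1).re := hd.2
  linarith

/-- THE MAJORANT IS BOUNDED: `|det(g + ix)|^{−σ} ≤ (det g)^{−σ}` for `σ ≥ 0`. -/
theorem norm_det_add_I_smul_rpow_neg_le {g : Matrix (Fin 2) (Fin 2) ℂ} (hg : g.PosDef) {σ : ℝ} (hσ : 0 ≤ σ) (c : ℝ × ℂ × ℝ) :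
    ‖(g + I • hermTwo c).det‖ ^ (-σ) ≤ ((g 0 0).re * (g 1 1).re - normSq (g 0 1)) ^ (-σ) := by
  have hδ := det_re_pos_of_posDef hg
  have hle := det_le_norm_det_add_I_smul hg c
  rw [Real.rpow_neg (norm_nonneg _), Real.rpow_neg hδ.le]
  exact inv_anti₀ (Real.rpow_pos_of_pos hδ σ) (Real.rpow_le_rpow hδ.le hle hσ)

/-- Pointwise constant bound of the `ξ`-integrand: `‖ξ-integrand‖ ≤ e^{2π(|im α|+|im β|)} · (det g)^{−re(α+β)}` when `re(α+β) ≥ 0`. -/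
theorem norm_xiTwoIntegrand_le_const {g h : Matrix (Fin 2) (Fin 2) ℂ} (hg : g.PosDef) (hh : h.IsHermitian) {α β : ℂ}
    (hαβ : 0 ≤ (α + β).re) (c : ℝ × ℂ × ℝ) :
    ‖xiTwoIntegrand g h α β c‖ ≤
      Real.exp (2 * Real.pi * (|α.im| + |β.im|)) * ((g 0 0).re * (g 1 1).re - normSq (g 0 1)) ^ (-(α + β).re) :=
  (norm_xiTwoIntegrand_le hg hh α β c).trans
    (mul_le_mul_of_nonneg_left (norm_det_add_I_smul_rpow_neg_le hg hαβ c) (Real.exp_pos _).le)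

/-! ## Continuity in `h` -/

/-- The `ξ`-integrand is continuous in the parameter `h = hermTwo e` for each fixed `x = hermTwo c`. -/
theorem continuous_xiTwoIntegrand_param (g : Matrix (Fin 2) (Fin 2) ℂ) (α β : ℂ) (c : ℝ × ℂ × ℝ) :
    Continuous fun e : ℝ × ℂ × ℝ => xiTwoIntegrand g (hermTwo e) α β c := by
  unfold xiTwoIntegrand
  refine Continuous.mul ?_ continuous_const
  refine Complex.continuous_exp.comp (continuous_const.mul ?_)
  have h : (fun e : ℝ × ℂ × ℝ => (hermTwo e * hermTwo c).trace) =
      fun e => ((e.1 * c.1 + e.2.2 * c.2.2 + 2 * (e.2.1 * conj c.2.1).re : ℝ) : ℂ) :=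
    funext fun e => trace_hermTwo_mul_hermTwo e c
  rw [h]
  fun_prop

/-- **CONTINUITY OF `ξ` IN `h`** (organ Φ6b-1⁺): for `g` positive definite and `re(α+β) > 3`, the map `h ↦ ξ(g, h; α, β)` is continuous on
the Hermitian matrices (chart `h = hermTwo e`, `e ∈ ℝ × ℂ × ℝ`) — dominated convergence with the `h`-independent majorant. -/
theorem continuous_xiTwo_hermTwo {g : Matrix (Fin 2) (Fin 2) ℂ} (hg : g.PosDef) {α β : ℂ} (hαβ : 3 < (α + β).re) :
    Continuous fun e : ℝ × ℂ × ℝ => xiTwo g (hermTwo e) α β := by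
  unfold xiTwo
  refine continuous_of_dominated (fun e => aestronglyMeasurable_xiTwoIntegrand g (hermTwo e) α β)
    (fun e => Filter.Eventually.of_forall fun c => norm_xiTwoIntegrand_le hg (isHermitian_hermTwo e) α β c)
    ((integrable_norm_det_add_I_smul_rpow_neg hg hαβ).const_mul (Real.exp (2 * Real.pi * (|α.im| + |β.im|))))
    (Filter.Eventually.of_forall fun c => continuous_xiTwoIntegrand_param g α β c)

/-- Continuity of `ξ` in `h` at a Hermitian `h`, matrix form: `ξ(g, ·; α, β) ∘ hermTwo` is continuous at the coordinates of `h`. -/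
theorem continuousAt_xiTwo {g h : Matrix (Fin 2) (Fin 2) ℂ} (hg : g.PosDef) (hh : h.IsHermitian) {α β : ℂ} (hαβ : 3 < (α + β).re) :
    ContinuousAt (fun e : ℝ × ℂ × ℝ => xiTwo g (hermTwo e) α β) ((h 0 0).re, h 0 1, (h 1 1).re) ∧
      hermTwo ((h 0 0).re, h 0 1, (h 1 1).re) = h :=
  ⟨(continuous_xiTwo_hermTwo hg hαβ).continuousAt, hermTwo_eq_of_isHermitian hh⟩

end Summit.HodgeConjecture.HodgeConjecture.Cruxes.HLiu418.K2LiuHermTwoConfluentXiRegularity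

end
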